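import Literature.Geometry.Riemannian.ClopenSubmanifoldMetric
import Literature.Geometry.Riemannian.OneFormPullback
import Literature.Geometry.Riemannian.L2HarmonicOneFormsSobolev
import Literature.Geometry.Riemannian.RicciDeTurckNaturality
import Literature.Geometry.Lorentzian.CauchyDevelopmentRestrict
import Literature.Geometry.Lorentzian.GeodesicProofs
import HarnessLib

/-!
# Completeness, Sobolev inequality, curvature and `L²` harmonic `1`-forms on an open-and-closed
# submanifold

Support file (all results proved) for removing the connectedness hypothesis from Carron's
finiteness theorem (`module_finite_l2HarmonicOneForms_of_boundarylessManifold`). For an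
open-and-closed subset `U : Opens X` (a union of connected components) of a Riemannian manifold
`(X, h)` with the restricted metric `hU = (Subtype.val)^* h` (`ClopenSubmanifoldMetric.lean`):

* `isGeodesicallyComplete_opens` — **`(U, hU)` is geodesically complete if `(X, h)` is**: a
  geodesic of `X` starting in `U` has connected image, hence stays in `U`; its corestriction is a
  geodesic of `U` (naturality of `D/dt` under the local isometry `Subtype.val`,
  `mfderiv_covariantDerivAlong_comap`);
* `innerDual_comap_comp` — the inverse metrics correspond on pulled-back covectors (any
  equidimensional immersion); `hasSobolevInequality_opens` — **`(S_p)` restricts to `U`**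
  (extend compactly supported functions of `U` by zero);
* `normSq_ricci_opens`, `lintegral_normSq_ricci_rpow_opens` — `|Ric_{hU}|² = |Ric_h|² ∘ val`,
  `∫_U |Ric_{hU}|^{p/2} = ∫_{x ∈ U} |Ric_h|^{p/2} ≤ ∫_X |Ric_h|^{p/2}`;
* `restrict_mem_l2HarmonicOneForms_opens` — **restriction maps `ℋ¹(X, h)` into `ℋ¹(U, hU)`**
  (`α ↦ (u ↦ α_{↑u})`; smoothness and naturality of `∇α` from `OneFormPullback.lean`).

O'Neill 1983, Ch. 3, p. 57, Prop. 3.59, Cor. 3.61. Everything is proved; no definitions, no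
named facts (D-0026).

## References

* B. O'Neill, *Semi-Riemannian geometry*, Academic Press 1983, Ch. 3, p. 57, Prop. 3.59,
  Cor. 3.61. [`ONeill1983`]
* G. Carron, *Formes harmoniques L² sur les variétés riemanniennes non-compactes*, mémoire
  d'habilitation (1999), §4.b. [`Carron1999HdR`]
-/

noncomputable section

open Bundle Set Function Filter Topology MeasureTheory Manifold
open scoped Manifold ContDiff ENNReal NNReal

namespace Literature.Geometry.Riemannian

open Literature.Geometry.Lorentzian
open Literature.Geometry.Lorentzian.PseudoRiemannianMetric
open Literature.Geometry.Manifold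

/-! ### The inverse metric on pulled-back covectors (equidimensional immersions) -/

section InnerDual

variable {E : Type*} [NormedAddCommGroup E] [NormedSpace ℝ E] {H : Type*} [TopologicalSpace H]
  {I : ModelWithCorners ℝ E H} {M : Type*} [TopologicalSpace M] [ChartedSpace H M]
  [IsManifold I ∞ M]
  {E' : Type*} [NormedAddCommGroup E'] [NormedSpace ℝ E'] {H' : Type*} [TopologicalSpace H']
  {I' : ModelWithCorners ℝ E' H'} {N : Type*} [TopologicalSpace N] [ChartedSpace H' N]
  [IsManifold I' ∞ N]
  [FiniteDimensional ℝ E] [FiniteDimensional ℝ E']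
  (g : PseudoRiemannianMetric I ∞ E (TangentSpace I : M → Type _))
  {Φ : N → M} (hpb : contMDiff_pullbackBilin I M I' N ∞)
  (hΦ : ContMDiff I' I ((∞ : ℕ∞ω) + 1) Φ)
  (hΦ' : ∀ u, Function.Injective (mfderiv I' I Φ u))
  (hdim : Module.finrank ℝ E' = Module.finrank ℝ E)

include hΦ' in
/-- **The inverse metrics correspond on pulled-back covectors** (any smooth equidimensional
immersion `Φ` and the pullback metric): `(Φ^*g)⁻¹_u(α ∘ dΦ_u, β ∘ dΦ_u) = g⁻¹_{Φ u}(α, β)`,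
because `♯^{Φ^*g}(β ∘ dΦ) = dΦ⁻¹ ♯^g β` (`sharp_comap_apply`). O'Neill 1983, Ch. 3, p. 60 with
Prop. 3.59. [cite: ONeill1983, Ch. 3, Prop. 3.59] -/
theorem innerDual_comap_comp (u : N) (α β : Module.Dual ℝ (TangentSpace I (Φ u))) :
    (g.comap hpb Φ hΦ hΦ' hdim).innerDual u (α.comp (mfderiv I' I Φ u).toLinearMap)
        (β.comp (mfderiv I' I Φ u).toLinearMap) = g.innerDual (Φ u) α β := by
  haveI : CompleteSpace E := FiniteDimensional.complete ℝ E
  haveI : CompleteSpace E' := FiniteDimensional.complete ℝ E'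
  set e := mfderivEquivOfInjective (I := I) (I' := I') Φ u (hΦ' u) hdim with he
  have heq : (mfderiv I' I Φ u).toLinearMap = e.toLinearMap := LinearMap.ext fun v ↦ rfl
  rw [heq]
  show (α.comp e.toLinearMap) ((g.comap hpb Φ hΦ hΦ' hdim).sharp u (β.comp e.toLinearMap)) =
    α (g.sharp (Φ u) β)
  rw [sharp_comap_apply g hpb hΦ hΦ' hdim u β, LinearMap.comp_apply]
  show α (e (e.symm (g.sharp (Φ u) β))) = α (g.sharp (Φ u) β)
  rw [e.apply_symm_apply]

end InnerDual

/-! ### Open-and-closed submanifolds -/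

variable {E : Type*} [NormedAddCommGroup E] [NormedSpace ℝ E] {H : Type*} [TopologicalSpace H]
  {I : ModelWithCorners ℝ E H} {X : Type*} [TopologicalSpace X] [ChartedSpace H X]
  [IsManifold I ∞ X] [FiniteDimensional ℝ E]
  {h : ContMDiffRiemannianMetric I ∞ E (TangentSpace I : X → Type _)}
  {U : TopologicalSpace.Opens X}
  {hU : ContMDiffRiemannianMetric I ∞ E (TangentSpace I : U → Type _)}

/-- Congruence of the covariant derivative along curves in the curve and the field (the tangent
spaces being the constant family `E`). [folklore] -/
private theorem covariantDerivAlong_congr''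
    (cov : CovariantDerivative I E (TangentSpace I : X → Type _)) {γ₁ γ₂ : ℝ → X} (hγ : γ₁ = γ₂)
    {W₁ : Π t : ℝ, TangentSpace I (γ₁ t)} {W₂ : Π t : ℝ, TangentSpace I (γ₂ t)}
    (hW : ∀ t, W₁ t = W₂ t) (t₀ : ℝ) :
    covariantDerivAlong cov γ₁ W₁ t₀ = covariantDerivAlong cov γ₂ W₂ t₀ := by
  subst hγ
  have : W₁ = W₂ := funext hW
  subst this
  rfl

omit [IsManifold I ∞ X] [FiniteDimensional ℝ E] in
/-- A curve of the open submanifold `U` is differentiable iff its composite with the inclusion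
is, and then the velocities agree (`d(Subtype.val) = id`). [folklore] -/
theorem velocity_subtypeVal_comp {γU : ℝ → U} {t : ℝ}
    (hγ : MDifferentiableAt 𝓘(ℝ, ℝ) I (Subtype.val ∘ γU) t) :
    velocity I (Subtype.val ∘ γU) t = velocity I γU t := by
  have hγU : MDifferentiableAt 𝓘(ℝ, ℝ) I γU t := (mdifferentiableAt_subtypeVal_comp_iff U).1 hγ
  simp only [velocity]
  rw [mfderiv_comp t (OpenSubmanifold.mdifferentiableAt_subtype_val _) hγU,
    OpenSubmanifold.mfderiv_subtype_val]
  rfl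

/-- **An open-and-closed submanifold of a geodesically complete manifold is geodesically
complete** (for the restricted metric): the complete geodesic `γ` of `X` with initial data
`(↑x, v)` has connected image meeting `U`, hence lies in the open-and-closed `U`; its
corestriction `γU` is twice differentiable (`mdifferentiableAt_totalSpace_opens_iff`) and
`D^{hU} γU'/dt = D^h γ'/dt = 0` (`mfderiv_covariantDerivAlong_comap` for the local isometry
`Subtype.val`). O'Neill 1983, Ch. 3, Prop. 3.59 and Cor. 3.61. [cite: ONeill1983, Ch. 3, Cor. 3.61] -/
theorem isGeodesicallyComplete_opens (hUc : IsClosed (U : Set X))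
    (hUeq : ofRiemannian hU = (ofRiemannian h).comap contMDiff_pullbackBilin_holds
      Subtype.val contMDiff_subtype_val (injective_mfderiv_subtype_val U) rfl)
    [(ofRiemannian hU).HasLeviCivita] [(ofRiemannian h).HasLeviCivita]
    (hc : IsGeodesicallyComplete (ofRiemannian h).leviCivita) :
    IsGeodesicallyComplete (ofRiemannian hU).leviCivita := by
  haveI : CompleteSpace E := FiniteDimensional.complete ℝ E
  intro x v
  obtain ⟨γ, hγ, h0, hv0⟩ := hc x.1 v
  have hγd : ∀ t, MDifferentiableAt 𝓘(ℝ, ℝ) I γ t := fun t ↦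
    mdifferentiableAt_of_mdifferentiableAt_lift (hγ.1 t (mem_univ t))
  have hcont : Continuous γ := continuous_iff_continuousAt.2 fun t ↦ (hγd t).continuousAt
  -- the image lies in `U`
  have hsub : range γ ⊆ (U : Set X) :=
    (isPreconnected_range hcont).subset_isClopen ⟨hUc, U.isOpen⟩ ⟨x.1, ⟨0, h0⟩, x.2⟩
  set γU : ℝ → U := fun t ↦ ⟨γ t, hsub ⟨t, rfl⟩⟩ with hγU
  have hval : Subtype.val ∘ γU = γ := funext fun t ↦ rfl
  have hvel : ∀ t, velocity I γU t = velocity I γ t := fun t ↦ by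
    show velocity I γU t = velocity I (Subtype.val ∘ γU) t
    exact (velocity_subtypeVal_comp (hval ▸ hγd t)).symm
  -- the tangent lift of `γU` is differentiable
  have hlift : ∀ t, MDifferentiableAt 𝓘(ℝ, ℝ) I.tangent (tangentLift I γU) t := by
    intro t
    have key := (mdifferentiableAt_totalSpace_opens_iff (I := I) (IX := 𝓘(ℝ, ℝ)) U (b := γU)
      (s := fun s ↦ velocity I γU s) (x₀ := t)).2
    refine key ?_
    have heq : (fun s ↦ (TotalSpace.mk' E ((γU s : X)) (velocity I γU s) : TangentBundle I X)) =
        tangentLift I γ := by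
      funext s
      rw [tangentLift, hvel s]
    rw [heq]
    exact hγ.1 t (mem_univ t)
  refine ⟨γU, ⟨fun t _ ↦ hlift t, fun t _ ↦ ?_⟩, Subtype.ext h0, by rw [hvel, hv0]⟩
  -- the geodesic equation, by naturality of `D/dt` for the pullback metric
  have key : ∀ (g' : PseudoRiemannianMetric I ∞ E (TangentSpace I : U → Type _))
      [g'.HasLeviCivita], g' = (ofRiemannian h).comap contMDiff_pullbackBilin_holds Subtype.val
        contMDiff_subtype_val (injective_mfderiv_subtype_val U) rfl →
      mfderiv I I (Subtype.val : U → X) (γU t)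
          (covariantDerivAlong g'.leviCivita γU (fun t ↦ velocity I γU t) t) =
        covariantDerivAlong (ofRiemannian h).leviCivita (Subtype.val ∘ γU)
          (fun t ↦ mfderiv I I (Subtype.val : U → X) (γU t) (velocity I γU t)) t := by
    intro g' _ hg'
    subst hg'
    exact mfderiv_covariantDerivAlong_comap (ofRiemannian h) contMDiff_pullbackBilin_holds
      contMDiff_subtype_val (injective_mfderiv_subtype_val U) rfl (hlift t)
  have h1 := key _ hUeq
  have h2 : ∀ s, mfderiv I I (Subtype.val : U → X) (γU s) (velocity I γU s) = velocity I γ s :=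
    fun s ↦ by rw [OpenSubmanifold.mfderiv_subtype_val]; exact hvel s
  rw [covariantDerivAlong_congr'' (ofRiemannian h).leviCivita hval h2 t, hγ.2 t (mem_univ t)] at h1
  exact injective_mfderiv_subtype_val U (γU t) (h1.trans (map_zero _).symm)

/-! ### The Sobolev inequality -/

section Sobolev

variable [T3Space X] [MeasurableSpace X] [BorelSpace X]

omit [T3Space X] [MeasurableSpace X] [BorelSpace X] in
/-- For a smooth function `ũ` on `X` extending `u : U → ℝ` (`ũ ∘ val = u`),
`|du|²_{hU}(u') = |dũ|²_h(↑u')`. [cite: ONeill1983, Ch. 3, Prop. 3.59] -/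
theorem innerDual_mvfderiv_opens
    (hUeq : ofRiemannian hU = (ofRiemannian h).comap contMDiff_pullbackBilin_holds
      Subtype.val contMDiff_subtype_val (injective_mfderiv_subtype_val U) rfl)
    {ũ : X → ℝ} {u : U → ℝ} (hũu : ũ ∘ Subtype.val = u) (y : U) (hd : MDiffAt ũ y.1) :
    (ofRiemannian hU).innerDual y (mvfderiv I u y).toLinearMap (mvfderiv I u y).toLinearMap =
      (ofRiemannian h).innerDual y.1 (mvfderiv I ũ y.1).toLinearMap
        (mvfderiv I ũ y.1).toLinearMap := by
  have hcomp : (mvfderiv I u y).toLinearMap = (mvfderiv I ũ y.1).toLinearMap.comp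
      (mfderiv I I (Subtype.val : U → X) y).toLinearMap := by
    refine LinearMap.ext fun v ↦ ?_
    rw [← hũu]
    exact mvfderiv_comp_apply hd (OpenSubmanifold.mdifferentiableAt_subtype_val _) v
  rw [hcomp, hUeq]
  exact innerDual_comap_comp (ofRiemannian h) contMDiff_pullbackBilin_holds
    contMDiff_subtype_val (injective_mfderiv_subtype_val U) rfl y _ _

/-- **The Sobolev inequality restricts to open-and-closed submanifolds**: if `(X, h)` satisfies
`(S_p)` with constant `μ` (`p > 2`), so does `(U, hU)` for an open-and-closed `U` with the
restricted metric — test against the extension by zero of `u ∈ C_c^∞(U)`, whose `L^{2p/(p-2)}`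
norm and Dirichlet energy are those of `u` (`lintegral_opens`, `innerDual_mvfderiv_opens`).
[cite: Carron1999HdR, §4.b] -/
theorem hasSobolevInequality_opens (hUc : IsClosed (U : Set X))
    (hUeq : ofRiemannian hU = (ofRiemannian h).comap contMDiff_pullbackBilin_holds
      Subtype.val contMDiff_subtype_val (injective_mfderiv_subtype_val U) rfl)
    {p μ : ℝ} (hp : 2 < p) (hS : HasSobolevInequality h p μ) : HasSobolevInequality hU p μ := by
  intro u hu huc
  set ũ : X → ℝ := Subtype.val.extend u 0 with hũdef
  have hũs : ContMDiff I 𝓘(ℝ, ℝ) ∞ ũ := ContMDiff.extend_zero huc hu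
  have hũc : HasCompactSupport ũ := huc.extend_zero continuous_subtype_val
  have hũu : ũ ∘ Subtype.val = u := extend_comp Subtype.val_injective _ _
  have hũ0 : ∀ x ∉ (U : Set X), ũ x = 0 := fun x hx ↦ by
    rw [hũdef, extend_apply' _ _ _ fun ⟨y, hy⟩ ↦ hx (hy ▸ y.2)]
    rfl
  have hSũ := hS ũ hũs hũc
  have hq0 : 0 < 2 * p / (p - 2) := div_pos (by linarith) (by linarith)
  -- the `L^q` side
  have hL : ∫⁻ x, ENNReal.ofReal (|ũ x| ^ (2 * p / (p - 2))) ∂riemannianMeasure h =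
      ∫⁻ y, ENNReal.ofReal (|u y| ^ (2 * p / (p - 2))) ∂riemannianMeasure hU := by
    rw [← lintegral_add_compl (μ := riemannianMeasure h) _ U.isOpen.measurableSet,
      setLIntegral_congr_fun (s := (U : Set X)ᶜ) U.isOpen.measurableSet.compl
        (g := fun _ ↦ 0) fun x hx ↦ by
          rw [hũ0 x hx, abs_zero, Real.zero_rpow hq0.ne', ENNReal.ofReal_zero],
      lintegral_zero, add_zero, ← lintegral_opens hUc hUeq]
    refine lintegral_congr fun y ↦ ?_
    rw [← hũu, Function.comp_apply]
  -- the energy side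
  have hR : ∫⁻ x, ENNReal.ofReal ((ofRiemannian h).innerDual x (mvfderiv I ũ x).toLinearMap
      (mvfderiv I ũ x).toLinearMap) ∂riemannianMeasure h =
      ∫⁻ y, ENNReal.ofReal ((ofRiemannian hU).innerDual y (mvfderiv I u y).toLinearMap
        (mvfderiv I u y).toLinearMap) ∂riemannianMeasure hU := by
    rw [← lintegral_add_compl (μ := riemannianMeasure h) _ U.isOpen.measurableSet,
      setLIntegral_congr_fun (s := (U : Set X)ᶜ) U.isOpen.measurableSet.compl
        (g := fun _ ↦ 0) fun x hx ↦ ?_, lintegral_zero, add_zero, ← lintegral_opens hUc hUeq]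
    · refine lintegral_congr fun y ↦ ?_
      rw [innerDual_mvfderiv_opens hUeq hũu y ((hũs _).mdifferentiableAt (by simp))]
    · -- off `U` the extension vanishes identically near `x`
      have hev : ũ =ᶠ[𝓝 x] fun _ ↦ 0 := by
        filter_upwards [hUc.isOpen_compl.mem_nhds hx] with z hz
        exact hũ0 z hz
      have hd0 : mvfderiv I ũ x = 0 := by
        rw [mvfderiv, hev.mfderiv_eq, mfderiv_const]
        rfl
      rw [hd0]
      simp [PseudoRiemannianMetric.innerDual]
  rw [hL, hR] at hSũ
  exact hSũ

end Sobolev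

/-! ### Curvature -/

/-- **`|Ric|²` of the restricted metric**: `|Ric_{hU}|²(u) = |Ric_h|²(↑u)` (`ricci_comap_apply`,
`normSq_comap_eq`). [cite: ONeill1983, Ch. 3, Prop. 3.59] -/
theorem normSq_ricci_opens
    (hUeq : ofRiemannian hU = (ofRiemannian h).comap contMDiff_pullbackBilin_holds
      Subtype.val contMDiff_subtype_val (injective_mfderiv_subtype_val U) rfl)
    [(ofRiemannian hU).HasLeviCivita] [(ofRiemannian h).HasLeviCivita] (u : U) :
    (ofRiemannian hU).normSq u ((ofRiemannian hU).ricci u) =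
      (ofRiemannian h).normSq u.1 ((ofRiemannian h).ricci u.1) := by
  haveI : CompleteSpace E := FiniteDimensional.complete ℝ E
  have key : ∀ (g' : PseudoRiemannianMetric I ∞ E (TangentSpace I : U → Type _))
      [g'.HasLeviCivita], g' = (ofRiemannian h).comap contMDiff_pullbackBilin_holds Subtype.val
        contMDiff_subtype_val (injective_mfderiv_subtype_val U) rfl →
      g'.normSq u (g'.ricci u) = (ofRiemannian h).normSq u.1 ((ofRiemannian h).ricci u.1) := by
    intro g' _ hg'
    subst hg'
    refine normSq_comap_eq (ofRiemannian h) contMDiff_pullbackBilin_holds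
      contMDiff_subtype_val (injective_mfderiv_subtype_val U) rfl u _ _
      fun v w ↦ ?_
    exact ricci_comap_apply (ofRiemannian h) contMDiff_pullbackBilin_holds
      contMDiff_subtype_val (injective_mfderiv_subtype_val U) rfl u v w
  exact key _ hUeq

section Ricci

variable [T3Space X] [MeasurableSpace X] [BorelSpace X]

/-- **`∫ |Ric|^{p/2}` of an open-and-closed submanifold** is the integral over `U ⊆ X`:
`∫_U (|Ric_{hU}|²)^{p/4} dV_{hU} = ∫_{x ∈ U} (|Ric_h|²)^{p/4} dV_h`. [cite: ONeill1983, Ch. 3, Prop. 3.59] -/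
theorem lintegral_normSq_ricci_rpow_opens (hUc : IsClosed (U : Set X))
    (hUeq : ofRiemannian hU = (ofRiemannian h).comap contMDiff_pullbackBilin_holds
      Subtype.val contMDiff_subtype_val (injective_mfderiv_subtype_val U) rfl)
    [(ofRiemannian hU).HasLeviCivita] [(ofRiemannian h).HasLeviCivita] (p : ℝ) :
    ∫⁻ u, ENNReal.ofReal (((ofRiemannian hU).normSq u ((ofRiemannian hU).ricci u)) ^ (p / 4))
        ∂riemannianMeasure hU =
      ∫⁻ x in (U : Set X), ENNReal.ofReal (((ofRiemannian h).normSq x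
        ((ofRiemannian h).ricci x)) ^ (p / 4)) ∂riemannianMeasure h := by
  rw [← lintegral_opens hUc hUeq]
  refine lintegral_congr fun u ↦ ?_
  rw [normSq_ricci_opens hUeq u]

end Ricci

/-! ### Restriction of `L²` harmonic `1`-forms -/

section Harmonic

variable [T3Space X] [MeasurableSpace X] [BorelSpace X]

omit [IsManifold I ∞ X] [FiniteDimensional ℝ E] [T3Space X] [MeasurableSpace X] [BorelSpace X] in
/-- The restriction of a `1`-form to `U` is its pullback along the inclusion (`d val = id`).
[folklore] -/
theorem restrict_oneForm_eq_pullback (α : Π x : X, TangentSpace I x →L[ℝ] ℝ) :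
    (fun u : U ↦ (α u.1 : TangentSpace I u →L[ℝ] ℝ)) =
      fun u : U ↦ (α (Subtype.val u)).comp (mfderiv I I (Subtype.val : U → X) u) := by
  funext u
  refine ContinuousLinearMap.ext fun v ↦ ?_
  show α u.1 v = α u.1 (mfderiv I I (Subtype.val : U → X) u v)
  rw [OpenSubmanifold.mfderiv_subtype_val]
  rfl

/-- **Restriction maps `ℋ¹(X, h)` into `ℋ¹(U, hU)`** for an open-and-closed `U` with the
restricted metric: `u ↦ α_{↑u}` is smooth (`contMDiffAt_oneFormSection_pullback`), square
integrable (`∫_U |α|² ≤ ∫_X |α|²`), closed and co-closed (naturality of `∇α`,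
`isSymm_covDerivOneForm_pullback`, `trace_covDerivOneForm_pullback`).
[cite: ONeill1983, Ch. 3, Prop. 3.59] -/
theorem restrict_mem_l2HarmonicOneForms_opens (hUc : IsClosed (U : Set X))
    (hUeq : ofRiemannian hU = (ofRiemannian h).comap contMDiff_pullbackBilin_holds
      Subtype.val contMDiff_subtype_val (injective_mfderiv_subtype_val U) rfl)
    [(ofRiemannian hU).HasLeviCivita] [(ofRiemannian h).HasLeviCivita]
    {α : Π x : X, TangentSpace I x →L[ℝ] ℝ} (hα : α ∈ l2HarmonicOneForms h) :
    (fun u : U ↦ (α u.1 : TangentSpace I u →L[ℝ] ℝ)) ∈ l2HarmonicOneForms hU := by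
  haveI : CompleteSpace E := FiniteDimensional.complete ℝ E
  obtain ⟨hs, hL2, hsy, htr⟩ := (mem_l2HarmonicOneForms_iff h).1 hα
  rw [restrict_oneForm_eq_pullback]
  have hvals : ∀ u : U, ContMDiffAt I I ∞ (Subtype.val : U → X) u := fun u ↦
    contMDiff_subtype_val u
  -- naturality of `∇α`
  have key : ∀ (g' : PseudoRiemannianMetric I ∞ E (TangentSpace I : U → Type _))
      [g'.HasLeviCivita], g' = (ofRiemannian h).comap contMDiff_pullbackBilin_holds Subtype.val
        contMDiff_subtype_val (injective_mfderiv_subtype_val U) rfl → ∀ u,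
      (g'.covDerivOneForm (fun u : U ↦ (α (Subtype.val u)).comp
          (mfderiv I I (Subtype.val : U → X) u)) u).IsSymm ∧
        g'.trace u (g'.covDerivOneForm (fun u : U ↦ (α (Subtype.val u)).comp
          (mfderiv I I (Subtype.val : U → X) u)) u) = 0 := by
    intro g' _ hg' u
    subst hg'
    refine ⟨isSymm_covDerivOneForm_pullback (ofRiemannian h) contMDiff_pullbackBilin_holds
      contMDiff_subtype_val (injective_mfderiv_subtype_val U) rfl (hs _)
      (hsy _), ?_⟩
    rw [trace_covDerivOneForm_pullback (ofRiemannian h) contMDiff_pullbackBilin_holds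
      contMDiff_subtype_val (injective_mfderiv_subtype_val U) rfl (hs _)]
    exact htr _
  have key' := key _ hUeq
  refine (mem_l2HarmonicOneForms_iff hU).2 ⟨fun u ↦ contMDiffAt_oneFormSection_pullback
    (hvals u) (hs _), ?_, fun u ↦ (key' u).1, fun u ↦ (key' u).2⟩
  -- the `L²` condition
  have hpt : ∀ u : U, (ofRiemannian hU).innerDual u
      ((α (Subtype.val u)).comp (mfderiv I I (Subtype.val : U → X) u)).toLinearMap
      ((α (Subtype.val u)).comp (mfderiv I I (Subtype.val : U → X) u)).toLinearMap =
      (ofRiemannian h).innerDual u.1 (α u.1).toLinearMap (α u.1).toLinearMap := by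
    intro u
    rw [hUeq]
    exact innerDual_comap_comp (ofRiemannian h) contMDiff_pullbackBilin_holds
      contMDiff_subtype_val (injective_mfderiv_subtype_val U) rfl u
      (α u.1).toLinearMap (α u.1).toLinearMap
  simp_rw [hpt]
  rw [lintegral_opens hUc hUeq (fun x ↦ ENNReal.ofReal ((ofRiemannian h).innerDual x
    (α x).toLinearMap (α x).toLinearMap))]
  exact lt_of_le_of_lt (lintegral_mono' Measure.restrict_le_self le_rfl) hL2

omit [T3Space X] [MeasurableSpace X] [BorelSpace X] in
/-- Restriction is compatible with the pointwise norm: `|α|_U|²_{hU}(u) = |α|²_h(↑u)`.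
[cite: ONeill1983, Ch. 3, Prop. 3.59] -/
theorem innerDual_restrict_opens
    (hUeq : ofRiemannian hU = (ofRiemannian h).comap contMDiff_pullbackBilin_holds
      Subtype.val contMDiff_subtype_val (injective_mfderiv_subtype_val U) rfl)
    (α β : Π x : X, TangentSpace I x →L[ℝ] ℝ) (u : U) :
    (ofRiemannian hU).innerDual u (α u.1 : TangentSpace I u →L[ℝ] ℝ).toLinearMap
        (β u.1 : TangentSpace I u →L[ℝ] ℝ).toLinearMap =
      (ofRiemannian h).innerDual u.1 (α u.1).toLinearMap (β u.1).toLinearMap := by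
  have h1 : ∀ γ : Π x : X, TangentSpace I x →L[ℝ] ℝ,
      (γ u.1).toLinearMap.comp (mfderiv I I (Subtype.val : U → X) u).toLinearMap =
        ((γ u.1 : TangentSpace I u →L[ℝ] ℝ)).toLinearMap := by
    intro γ
    refine LinearMap.ext fun v ↦ ?_
    show γ u.1 (mfderiv I I (Subtype.val : U → X) u v) = γ u.1 v
    rw [OpenSubmanifold.mfderiv_subtype_val]
    rfl
  have key := innerDual_comap_comp (ofRiemannian h) contMDiff_pullbackBilin_holds
    contMDiff_subtype_val (injective_mfderiv_subtype_val U) rfl u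
    (α u.1).toLinearMap (β u.1).toLinearMap
  rw [h1 α, h1 β, ← hUeq] at key
  exact key

end Harmonic

end Literature.Geometry.Riemannian

end
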